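import Summits.HodgeConjecture.HodgeConjecture.Theorems.NikulinTwinTransportTwinTwistorTransportReduction
import Summits.HodgeConjecture.HodgeConjecture.Theorems.PadicSemiregularLiftHodgeAbelianVarietiesStarSeedsEngine
import Summits.HodgeConjecture.HodgeConjecture.Theses.PadicSemiregularLift
import Literature.AlgebraicGeometry.Crystalline.PadicAnchorDefs
import Literature.AlgebraicGeometry.Surfaces.K3ComplexMultiplication
import Summits.HodgeConjecture.HodgeConjecture.Theorems.NikulinTwinTransportTwinTwistorTransportTwinModelDefs

/-!
# Route NikulinTwinTransport · crux `TwinTwistorTransport` (stmt-HodgeConjecture-14393) · line `ordinary-prime-anchors` —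
# HEART GLUE: the planner's `p`-adic variational Hodge heart from formal seeds + Grothendieck existence, and its HC-honesty

Lead c2, line `ordinary-prime-anchors`, reshapes r3/r4. Over the landed DEFINITIONS layer `…TwinModelDefs` (p110729): the planner's heart
`TwinPVHC[]` (rational `p`-adic variational Hodge for the twin class on a genuine twin model with divisorial special fibre) FOLLOWS from the line's
smaller research stub `TwinFormalSeeds[]` (registered `stub_twinFormalSeeds`: a non-zero multiple of `u = sp(γ)` is a `ℤ`-combination of `ch₂^cris`
of FORMALLY LIFTABLE modules) and Grothendieck existence for formal vector bundles — the sibling route's crux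
`PadicSemiregularLift.FormalVectorBundlesAlgebraize` (stmt-HodgeConjecture-14106) taken BY NAME — through the landed engine lemma
`…InnerFormInvariantSeeds.Engine.bo_mem_span_of_formalSeedClasses` (`bo(ch₂^cris(E|₀)) = ch₂^dR(E_K) ∈ A²(W_K)`, `ℚ`-saturation, `bo u = γ_dR`);
and it is at most HC-strength modulo the residual `TwinModel.CycleDescent` (`twinPVHC_of_hodgeConjectureFor_products`).  In print the cut is tight
(Chern-character isomorphism `K₀ ⊗ ℚ ≅ CH* ⊗ ℚ`, extension + resolution of `ξ` by vector bundles on the regular scheme `𝒲`, `bo` bijective), so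
the research content of the line is exactly `stub_twinFormalSeeds` (Bloch–Esnault–Kerz, Invent. Math. 195 (2014) Thm. 1.3 and remark (iii):
the pro-`K₀` class lift is free under the Hodge condition; its object-level algebraization is the open part).
-/

noncomputable section

set_option linter.dupNamespace false

namespace Summit.HodgeConjecture.HodgeConjecture.Theorems.NikulinTwinTransport.OrdinaryPrimeAnchors

open CategoryTheory MonoidalCategory
open scoped Isocrystal
open Literature.AlgebraicGeometry.Motives Literature.AlgebraicGeometry.HodgeTheory
open Literature.AlgebraicGeometry.Surfaces
open Literature.AlgebraicTopology.SingularHomology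
open Literature.AlgebraicGeometry.Crystalline
open Summit.HodgeConjecture.HodgeConjecture.Theses.NikulinTwinTransport

local notation3 (prettyPrint := false) "MarkedK3[" S ", " η ", " p ", " x "]" =>
  (IsIntegralClass p ∧
    (∀ q : complexBetti S (2 * 2), IsIntegralClass q → ∃ n : ℤ, q = n • p) ∧
    (∀ c : complexBetti S (2 * 1), IsIntegralClass c ↔ ∃ v : K3Index → ℤ, η c = fun i => (v i : ℂ)) ∧
    (∀ a b : complexBetti S (2 * 1),
        cupProduct (rfl : 2 * 1 + 2 * 1 = 2 * 2) a b = k3Form (η a) (η b) • p) ∧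
    IsOfHodgeType 2 S (2 * 1) 2 0 (LinearEquiv.symm η x) ∧
    (∀ τ : complexBetti S (2 * 1), IsOfHodgeType 2 S (2 * 1) 2 0 τ → ∃ t : ℂ, τ = t • LinearEquiv.symm η x))

local notation3 (prettyPrint := false) "PeriodPt[" x "]" =>
  (k3Form x x = 0 ∧ 0 < (k3Form (star x) x).re ∧
    ∃ u : K3Index → ℤ, k3Form (fun i => (u i : ℂ)) x = 0 ∧ 0 < ∑ i, ∑ j, u i * k3Gram i j * u j)

local notation3 (prettyPrint := false) "Latt[" M ", " N "]" =>
  ((∀ v : K3Index → ℤ, ∃ w : K3Index → ℚ, M (fun i => (v i : ℂ)) = fun i => (w i : ℂ)) ∧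
    (∀ v : K3Index → ℤ, ∃ w : K3Index → ℚ, N (fun i => (v i : ℂ)) = fun i => (w i : ℂ)) ∧
    M * N = 1 ∧ N * M = 1 ∧
    (∀ a b, k3Form (M a) (M b) = 2 * k3Form a b))



/-- `TwinPVHC[]`: the planner's heart (A3) — rational `p`-adic variational Hodge for the twin class of a marked projective `M`-twin pair
on a genuine twin model with divisorial special fibre. Local notation only, verbatim from the line skeleton (reshape r4). -/
local notation3 (prettyPrint := false) "TwinPVHC[]" =>
  ∀ (M N : Module.End ℂ (K3Index → ℂ)), Latt[M, N] →
    ∀ (μ : OrientationFamily), μ.HasPoincareDuality →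
      ∀ (S₂ S₂' : SchemeOver ℂ) (hS₂ : IsK3Surface S₂) (hS₂' : IsK3Surface S₂')
        (η₂ : complexBetti S₂ (2 * 1) ≃ₗ[ℂ] (K3Index → ℂ)) (p₂ : complexBetti S₂ (2 * 2)) (x₂ : K3Index → ℂ)
        (η₂' : complexBetti S₂' (2 * 1) ≃ₗ[ℂ] (K3Index → ℂ)) (p₂' : complexBetti S₂' (2 * 2)) (x₂' : K3Index → ℂ),
        MarkedK3[S₂, η₂, p₂, x₂] → PeriodPt[x₂] → MarkedK3[S₂', η₂', p₂', x₂'] → PeriodPt[x₂'] →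
        (∃ t : ℂ, M x₂' = t • x₂) →
        ∀ D : TwinModel μ S₂ S₂' hS₂ hS₂' η₂ η₂' M, D.IsGenuine →
          PadicAnchor.DivisorClassesAreChern D.C (WittScheme.specialFibre D.𝒲) →
          PadicAnchor.RationallyLefschetz D.C (WittScheme.specialFibre D.𝒲) →
          D.u ∈ D.C.ratAlgebraicClasses (WittScheme.specialFibre D.𝒲) 2 →
          D.γdR ∈ Submodule.span K(D.p, D.k)
            (D.C.dR.ratAlgebraicClasses (WittScheme.genericFibre D.𝒲) 2 :
              Set (D.C.dR.obj (WittScheme.genericFibre D.𝒲) (2 * 2)))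

/-- `FormalSeeds[D]`: a non-zero multiple of `u = sp(γ)` is a `ℤ`-combination of `ch₂^cris` of formally liftable modules on the special
fibre. Local notation only, verbatim from the line skeleton (reshape r3). -/
local notation3 (prettyPrint := false) "FormalSeeds[" D "]" =>
  ∃ N : ℤ, N ≠ 0 ∧ N • TwinModel.u D ∈ AddSubgroup.closure
    {x | ∃ E : (WittScheme.specialFibre (TwinModel.𝒲 D)).left.Modules, WittScheme.LiftsFormally (TwinModel.𝒲 D) E ∧
      x = (TwinModel.C D).chCris (WittScheme.specialFibre (TwinModel.𝒲 D)) E 2}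

/-- `TwinFormalSeeds[]`: the research heart of the line after reshape r3 (registered stub `stub_twinFormalSeeds`), as a closed statement.
Local notation only, verbatim from the line skeleton. -/
local notation3 (prettyPrint := false) "TwinFormalSeeds[]" =>
  ∀ (M N : Module.End ℂ (K3Index → ℂ)), Latt[M, N] →
    ∀ (μ : OrientationFamily), μ.HasPoincareDuality →
      ∀ (S₂ S₂' : SchemeOver ℂ) (hS₂ : IsK3Surface S₂) (hS₂' : IsK3Surface S₂')
        (η₂ : complexBetti S₂ (2 * 1) ≃ₗ[ℂ] (K3Index → ℂ)) (p₂ : complexBetti S₂ (2 * 2)) (x₂ : K3Index → ℂ)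
        (η₂' : complexBetti S₂' (2 * 1) ≃ₗ[ℂ] (K3Index → ℂ)) (p₂' : complexBetti S₂' (2 * 2)) (x₂' : K3Index → ℂ),
        MarkedK3[S₂, η₂, p₂, x₂] → PeriodPt[x₂] → MarkedK3[S₂', η₂', p₂', x₂'] → PeriodPt[x₂'] →
        (∃ t : ℂ, M x₂' = t • x₂) →
        ∀ D : TwinModel μ S₂ S₂' hS₂ hS₂' η₂ η₂' M, D.IsGenuine →
          PadicAnchor.DivisorClassesAreChern D.C (WittScheme.specialFibre D.𝒲) →
          PadicAnchor.RationallyLefschetz D.C (WittScheme.specialFibre D.𝒲) →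
          D.u ∈ D.C.ratAlgebraicClasses (WittScheme.specialFibre D.𝒲) 2 → FormalSeeds[D]


/-- **Registered sub-goal `twinModel_span_of_formalSeeds`** (the heart glue POINTWISE, all binders explicit): on any twin model, formal seeds for
`u = sp(γ)` plus Grothendieck existence for formal vector bundles (`FormalVectorBundlesAlgebraize`, crux 14106 of PadicSemiregularLift, by name) give
`γ_dR ∈ K · A²(W_K)` — the conclusion of the planner's `p`-adic variational Hodge heart (sibling engine `bo_mem_span_of_formalSeedClasses` + `bo u = γ_dR`). -/
theorem twinModel_span_of_formalSeeds : ∀ (μ : OrientationFamily) (S S' : SchemeOver ℂ) (hS : IsK3Surface S) (hS' : IsK3Surface S') (η : complexBetti S (2 * 1) ≃ₗ[ℂ] (K3Index → ℂ)) (η' : complexBetti S' (2 * 1) ≃ₗ[ℂ] (K3Index → ℂ)) (M : Module.End ℂ (K3Index → ℂ)) (D : TwinModel μ S S' hS hS' η η' M), Summit.HodgeConjecture.HodgeConjecture.Theses.PadicSemiregularLift.FormalVectorBundlesAlgebraize → (∃ N : ℤ, N ≠ 0 ∧ N • TwinModel.u D ∈ AddSubgroup.closure {x | ∃ E : (WittScheme.specialFibre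 (TwinModel.𝒲 D)).left.Modules, WittScheme.LiftsFormally (TwinModel.𝒲 D) E ∧ x = (TwinModel.C D).chCris (WittScheme.specialFibre (TwinModel.𝒲 D)) E 2}) → D.γdR ∈ Submodule.span K(D.p, D.k) (D.C.dR.ratAlgebraicClasses (WittScheme.genericFibre D.𝒲) 2 : Set (D.C.dR.obj (WittScheme.genericFibre D.𝒲) (2 * 2))) := by
  intro μ S S' hS hS' η η' M D hP3a hF
  obtain ⟨N₀, hN₀, hcl⟩ := hF
  have key := Summit.HodgeConjecture.HodgeConjecture.Cruxes.HodgeAbelianVarieties.InnerFormInvariantSeeds.Engine.bo_mem_span_of_formalSeedClasses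
    hP3a D.C D.model (r := 2) hN₀ hcl
  rw [D.bo_u] at key
  exact key

/-- **The planner's heart from formal seeds + Grothendieck existence** (reshape r3, the cut along the sibling engine): formal seeds
(`TwinFormalSeeds[]`) put `N • u` in the closure of `ch₂^cris` of formally liftable modules; `FormalVectorBundlesAlgebraize` (route
PadicSemiregularLift crux 14106, by name) algebraizes them; `bo(ch₂^cris(E|₀)) = ch₂^dR(E_K) ∈ A²(W_K)` and `ℚ`-saturation
(`…Engine.bo_mem_span_of_formalSeedClasses`); `bo u = γ_dR`. -/
theorem twinPVHC_of_twinFormalSeeds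
    (hP3a : Summit.HodgeConjecture.HodgeConjecture.Theses.PadicSemiregularLift.FormalVectorBundlesAlgebraize)
    (hS : TwinFormalSeeds[]) : TwinPVHC[] := by
  intro M N hlatt μ hμ S₂ S₂' hS₂ hS₂' η₂ p₂ x₂ η₂' p₂' x₂' hm hx hm' hx' hper D hG hDC hRL hu
  obtain ⟨N₀, hN₀, hcl⟩ := hS M N hlatt μ hμ S₂ S₂' hS₂ hS₂' η₂ p₂ x₂ η₂' p₂' x₂' hm hx hm' hx' hper D hG hDC hRL hu
  have key := Summit.HodgeConjecture.HodgeConjecture.Cruxes.HodgeAbelianVarieties.InnerFormInvariantSeeds.Engine.bo_mem_span_of_formalSeedClasses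
    hP3a D.C D.model (r := 2) hN₀ hcl
  rw [D.bo_u] at key
  exact key

/-- **The planner's heart is at most HC-strength**: on a genuine twin model `γB` is a rational `(2,2)`-class, so the Hodge conjecture for the
product `S ⊗ S'` makes it algebraic and cycle descent at the model (the residual predicate `TwinModel.CycleDescent`, an explicit
hypothesis) gives `γ_dR ∈ K · A²(W_K)`; a counterexample to `TwinPVHC[]` is therefore a non-algebraic Hodge class on a product of two
projective K3 surfaces or a failure of descent to `K`. -/
theorem twinPVHC_of_hodgeConjectureFor_products
    (hHC : ∀ (S S' : SchemeOver ℂ), IsK3Surface S → IsK3Surface S' →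
      HodgeConjectureFor 4 (MonoidalCategoryStruct.tensorObj S S'))
    (hdesc : ∀ (μ : OrientationFamily) (S S' : SchemeOver ℂ) (hS : IsK3Surface S) (hS' : IsK3Surface S')
      (η : complexBetti S (2 * 1) ≃ₗ[ℂ] (K3Index → ℂ)) (η' : complexBetti S' (2 * 1) ≃ₗ[ℂ] (K3Index → ℂ))
      (M : Module.End ℂ (K3Index → ℂ)) (D : TwinModel μ S S' hS hS' η η' M), D.IsGenuine → D.CycleDescent) : TwinPVHC[] := by
  intro M N _ μ _ S₂ S₂' hS₂ hS₂' η₂ p₂ x₂ η₂' p₂' x₂' _ _ _ _ _ D hG _ _ _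
  refine hdesc μ S₂ S₂' hS₂ hS₂' η₂ η₂' M D hG 2 D.γdR ?_
  rw [D.cmp_γdR]
  exact (hHC S₂ S₂' hS₂ hS₂').2 2 D.γB hG.rational hG.hodgeType

end Summit.HodgeConjecture.HodgeConjecture.Theorems.NikulinTwinTransport.OrdinaryPrimeAnchors

end
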